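import Literature.NumberTheory.LFunctions.YoshidaWindowGramTailMSBoxes
import Literature.NumberTheory.LFunctions.YoshidaWindowGramTailJFactoredScaled
import HarnessLib

/-!
# Kernel enclosures of Yoshida's matrix coefficients — VIII-f: the MEAN-SQUARE order-`J` tails in factored, rescaled form

Source: H. Yoshida, Adv. Stud. Pure Math. **21** (1992) 281–325, §§5–7 [Yoshida1992HermitianForms]; R. E. Moore,
*Interval Analysis* (1966), Ch. 3 [Moore1966] (inclusion property).

Part VIII-b gives the mean-square tails `U2EvenJMS` / `U2OddJMS` in structured form (`U2EvenJMS'`: the same Hankel–Gram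
skeleton as the order-`J` tail of part VII-a, with `hankHMS (msConst …) (msRes …)` on the A-family).  As in parts
VII-d/VII-e (which this file reuses for the left factors `phiJe(S)`/`phiJo(S)` and the diagonals `dgJe`/`dgJo`, identical
here), the column-band kit wants `U₂(i,i') = Σ_{r<2J} φ_r(i)ψ_r(i') + [i=i']dg(i)` with unit-size factors:

* `Encl.psiMSe`, `Encl.psiMSeS = ψ·B^{p(r)}` and `Encl.U2EvenJMS_eq_factoredS` (left factors `phiJeS`, diagonal `dgJe`);
  boxes `psiMSeBox`, `psiMSeSBox` with `mem` lemmas (sine data `s = sFun/sFun2` as in part VIII-c); `U2EvenJMS_comm`;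
* the odd analogues `psiMSo`, `psiMSoS`, `U2OddJMS_eq_factoredS`, `psiMSoBox`, `psiMSoSBox`, `U2OddJMS_comm`.

Everything is proved; no named facts.
-/

open Real Complex Finset Matrix
open scoped BigOperators

namespace Literature.NumberTheory.LFunctions.Yoshida1992

open Literature.Analysis.SpecialFunctions Literature.Analysis.ValidatedNumerics.NumericsMP
open Literature.Analysis.ValidatedNumerics

namespace Encl

variable {S : ℕ} {a : ℝ} {ks : List PrimeLen} {C : Consts}

/-! ## Even sector -/

/-- Right factors of the mean-square tail (even). [cite: Yoshida1992HermitianForms, §7 pp. 305–312] -/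
noncomputable def psiMSe (a θ η d₀ : ℝ) (B B₃ J : ℕ) (s₁ : ℕ → ℝ) (sm sp : ℕ → ℕ → ℝ) (i' r : ℕ) : ℝ :=
  if r < J then
    (1 + θ) * (1 + η) * (1 / (π ^ 2 * d₀)) *
      ∑ j' ∈ Finset.range J, hankHMS (msConst a B₃ s₁ sm sp) (msRes a s₁ sm sp) pA (B₃ - 1) B₃ B B₃ J r j' * vAe i' j'
  else
    (1 + θ) * (1 + η⁻¹) * (1 / d₀) *
      ∑ r' ∈ Finset.range J, hankH pB (B₃ - 1) B₃ B J (r - J) r' * vBe a i' r'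

/-- `ψ·B^{p(r)}`. [cite: Yoshida1992HermitianForms, §7 pp. 305–312] -/
noncomputable def psiMSeS (a θ η d₀ : ℝ) (B B₃ J : ℕ) (s₁ : ℕ → ℝ) (sm sp : ℕ → ℕ → ℝ) (i' r : ℕ) : ℝ :=
  psiMSe a θ η d₀ B B₃ J s₁ sm sp i' r * (B : ℝ) ^ pJe J r

/-- **`U₂⁺(MS) = Σ_{r<2J} φ_r ψ_rᵀ + diag`** (unscaled). [cite: Yoshida1992HermitianForms, §7 pp. 305–312] -/
theorem U2EvenJMS_eq_factored (a θ η d₀ : ℝ) (B B₃ J : ℕ) (s₁ : ℕ → ℝ) (sm sp : ℕ → ℕ → ℝ) (i i' : ℕ) :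
    U2EvenJMS a θ η d₀ B B₃ J s₁ sm sp i i'
      = (∑ r ∈ Finset.range (J + J), phiJe a J i r * psiMSe a θ η d₀ B B₃ J s₁ sm sp i' r)
        + (if i = i' then dgJe a θ d₀ B B₃ J i else 0) := by
  rw [← U2EvenJMS'_eq, Finset.sum_range_add]
  unfold U2EvenJMS' phiJe psiMSe dgJe
  have hA : ∀ r ∈ Finset.range J, (if r < J then vAe i r else vBe a i (r - J)) *
      (if r < J then (1 + θ) * (1 + η) * (1 / (π ^ 2 * d₀)) *
          ∑ j' ∈ Finset.range J, hankHMS (msConst a B₃ s₁ sm sp) (msRes a s₁ sm sp) pA (B₃ - 1) B₃ B B₃ J r j' * vAe i' j'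
        else (1 + θ) * (1 + η⁻¹) * (1 / d₀) *
          ∑ r' ∈ Finset.range J, hankH pB (B₃ - 1) B₃ B J (r - J) r' * vBe a i' r')
      = (1 + θ) * (1 + η) * (1 / (π ^ 2 * d₀)) *
          ∑ j' ∈ Finset.range J, hankHMS (msConst a B₃ s₁ sm sp) (msRes a s₁ sm sp) pA (B₃ - 1) B₃ B B₃ J r j'
            * vAe i r * vAe i' j' := by
    intro r hr
    rw [if_pos (Finset.mem_range.mp hr), if_pos (Finset.mem_range.mp hr), Finset.mul_sum, Finset.mul_sum, Finset.mul_sum]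
    exact Finset.sum_congr rfl fun j' _ ↦ by ring
  have hB : ∀ r ∈ Finset.range J, (if J + r < J then vAe i (J + r) else vBe a i (J + r - J)) *
      (if J + r < J then (1 + θ) * (1 + η) * (1 / (π ^ 2 * d₀)) *
          ∑ j' ∈ Finset.range J, hankHMS (msConst a B₃ s₁ sm sp) (msRes a s₁ sm sp) pA (B₃ - 1) B₃ B B₃ J (J + r) j' * vAe i' j'
        else (1 + θ) * (1 + η⁻¹) * (1 / d₀) *
          ∑ r' ∈ Finset.range J, hankH pB (B₃ - 1) B₃ B J (J + r - J) r' * vBe a i' r')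
      = (1 + θ) * (1 + η⁻¹) * (1 / d₀) *
          ∑ r' ∈ Finset.range J, hankH pB (B₃ - 1) B₃ B J r r' * vBe a i r * vBe a i' r' := by
    intro r _
    rw [if_neg (by omega), if_neg (by omega), Nat.add_sub_cancel_left, Finset.mul_sum, Finset.mul_sum, Finset.mul_sum]
    exact Finset.sum_congr rfl fun r' _ ↦ by ring
  rw [Finset.sum_congr rfl hA, Finset.sum_congr rfl hB, ← Finset.mul_sum, ← Finset.mul_sum]

/-- **`U₂⁺(MS) = Σ_{r<2J} (φ_r/λ_r)(ψ_r λ_r)ᵀ + diag`** (`B > 0`). [cite: Yoshida1992HermitianForms, §7 pp. 305–312] -/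
theorem U2EvenJMS_eq_factoredS (a θ η d₀ : ℝ) {B : ℕ} (hB : 0 < B) (B₃ J : ℕ) (s₁ : ℕ → ℝ) (sm sp : ℕ → ℕ → ℝ)
    (i i' : ℕ) :
    U2EvenJMS a θ η d₀ B B₃ J s₁ sm sp i i'
      = (∑ r ∈ Finset.range (J + J), phiJeS a B J i r * psiMSeS a θ η d₀ B B₃ J s₁ sm sp i' r)
        + (if i = i' then dgJe a θ d₀ B B₃ J i else 0) := by
  rw [U2EvenJMS_eq_factored]
  congr 1
  refine Finset.sum_congr rfl fun r _ ↦ ?_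
  unfold phiJeS psiMSeS
  have hBp : ((B : ℝ)) ^ pJe J r ≠ 0 := pow_ne_zero _ (by exact_mod_cast hB.ne')
  field_simp

/-- `hankHMS` is symmetric. [cite: Yoshida1992HermitianForms, §7 pp. 305–312] -/
theorem hankHMS_comm (c R : ℝ) (p : ℕ → ℕ) (X Y B Z Je j j' : ℕ) (h : j ≠ j') :
    hankHMS c R p X Y B Z Je j j' = hankHMS c R p X Y B Z Je j' j := by
  unfold hankHMS
  rw [if_neg h, if_neg (Ne.symm h), Nat.add_comm (p j) (p j')]

/-- `U₂⁺(MS)(i,i') = U₂⁺(MS)(i',i)`. [cite: Yoshida1992HermitianForms, §7 pp. 305–312] -/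
theorem U2EvenJMS_comm (a θ η d₀ : ℝ) (B B₃ J : ℕ) (s₁ : ℕ → ℝ) (sm sp : ℕ → ℕ → ℝ) (i i' : ℕ) :
    U2EvenJMS a θ η d₀ B B₃ J s₁ sm sp i i' = U2EvenJMS a θ η d₀ B B₃ J s₁ sm sp i' i := by
  rw [← U2EvenJMS'_eq, ← U2EvenJMS'_eq]
  unfold U2EvenJMS'
  have hsA : ∑ j ∈ Finset.range J, ∑ j' ∈ Finset.range J,
        hankHMS (msConst a B₃ s₁ sm sp) (msRes a s₁ sm sp) pA (B₃ - 1) B₃ B B₃ J j j' * vAe i j * vAe i' j'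
      = ∑ j ∈ Finset.range J, ∑ j' ∈ Finset.range J,
        hankHMS (msConst a B₃ s₁ sm sp) (msRes a s₁ sm sp) pA (B₃ - 1) B₃ B B₃ J j j' * vAe i' j * vAe i j' := by
    rw [Finset.sum_comm]
    refine Finset.sum_congr rfl fun j _ ↦ Finset.sum_congr rfl fun j' _ ↦ ?_
    by_cases hjj : j' = j
    · subst hjj; ring
    · rw [hankHMS_comm _ _ _ _ _ _ _ _ _ _ hjj]; ring
  have hsB : ∑ r ∈ Finset.range J, ∑ r' ∈ Finset.range J, hankH pB (B₃ - 1) B₃ B J r r' * vBe a i r * vBe a i' r'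
      = ∑ r ∈ Finset.range J, ∑ r' ∈ Finset.range J, hankH pB (B₃ - 1) B₃ B J r r' * vBe a i' r * vBe a i r' := by
    rw [Finset.sum_comm]
    refine Finset.sum_congr rfl fun r _ ↦ Finset.sum_congr rfl fun r' _ ↦ ?_
    by_cases hrr : r' = r
    · subst hrr; ring
    · rw [hankH_comm _ _ _ _ _ _ _ hrr]; ring
  rw [hsA, hsB]
  by_cases hii : i = i'
  · subst hii; rfl
  · rw [if_neg hii, if_neg (Ne.symm hii)]

/-- Box of `ψ⁺(MS)_r(i')` (record of mode `i'`; sine data `sd1/sdm/sdp` at unit `2^{−cs}`).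
[cite: Moore1966, Ch. 3 (interval arithmetic: inclusion property)] -/
def psiMSeBox (S : ℕ) (C : Consts) (F : FDConsts) (ks : List PrimeLen) (R : IdxRec)
    (cd d0z Be B3e Je θn θd ηn ηd cs : ℕ) (sd1 : List ℕ) (sdm sdp : List (List ℕ)) (i' r : ℕ) : MI :=
  if r < Je then
    ((((MI.ofInt S 1).mul S F.invPi2).mulInt (((θd + θn) * (ηd + ηn) * 2 ^ cd : ℕ) : ℤ)).divNat (θd * ηd * d0z)).mul S
      (sumBox S (fun j' ↦ (hankHMSBox S (msConstBox S C F ks B3e sd1 sdm sdp) (msResBox S C ks sd1 sdm sdp cs)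
        pA (B3e - 1) B3e Be B3e Je r j').mul S (vAeBox S i' j')) Je)
  else
    (((MI.ofInt S 1).mulInt (((θd + θn) * (ηn + ηd) * 2 ^ cd : ℕ) : ℤ)).divNat (θd * ηn * d0z)).mul S
      (sumBox S (fun r' ↦ (hankHBox S pB (B3e - 1) B3e Be Je (r - Je) r').mul S (vBeBox S C F R i' r')) Je)

/-- [cite: Moore1966, Ch. 3 (interval arithmetic: inclusion property)] -/
theorem mem_psiMSeBox (hS : 0 < S) (hks : PrimeData a ks) (hC : ConstsValid S a ks C) {F : FDConsts}
    (hF : FDValid S a F) {cd d0z Be B3e Je θn θd ηn ηd cs : ℕ} {sd1 : List ℕ} {sdm sdp : List (List ℕ)}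
    (hd0 : 0 < d0z) (hθn : 0 < θn) (hθd : 0 < θd) (hηn : 0 < ηn) (hηd : 0 < ηd) (hBe : 0 < Be) (hB3 : 2 ≤ B3e)
    {i' r : ℕ} {R : IdxRec} (hR : OffValid S a ks (i' : ℤ) R) :
    MI.mem S (psiMSe a ((θn : ℝ) / θd) ((ηn : ℝ) / ηd) ((d0z : ℝ) * (1 / 2 ^ cd)) Be B3e Je
        (sFun sd1 cs) (sFun2 sdm cs) (sFun2 sdp cs) i' r)
      (psiMSeBox S C F ks R cd d0z Be B3e Je θn θd ηn ηd cs sd1 sdm sdp i' r) := by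
  have hX : 0 < B3e - 1 := by omega
  have hπ : (π : ℝ) ≠ 0 := Real.pi_ne_zero
  have hθd' : (θd : ℝ) ≠ 0 := by exact_mod_cast hθd.ne'
  have hθn' : (θn : ℝ) ≠ 0 := by exact_mod_cast hθn.ne'
  have hηd' : (ηd : ℝ) ≠ 0 := by exact_mod_cast hηd.ne'
  have hηn' : (ηn : ℝ) ≠ 0 := by exact_mod_cast hηn.ne'
  have hd0' : (d0z : ℝ) ≠ 0 := by exact_mod_cast hd0.ne'
  have h2 : (2 : ℝ) ^ cd ≠ 0 := by positivity
  have hpA : ∀ j, 1 ≤ pA j := fun j ↦ by simp [pA]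
  have hpB : ∀ j, 1 ≤ pB j := fun j ↦ by simp [pB]
  have hcM := mem_msConstBox hS hks hC hF (Y := B3e) (by omega) sd1 sdm sdp cs
  have hcR := mem_msResBox hS hks hC sd1 sdm sdp cs
  have hcA : MI.mem S ((1 + (θn : ℝ) / θd) * (1 + (ηn : ℝ) / ηd) * (1 / (π ^ 2 * ((d0z : ℝ) * (1 / 2 ^ cd)))))
      ((((MI.ofInt S 1).mul S F.invPi2).mulInt (((θd + θn) * (ηd + ηn) * 2 ^ cd : ℕ) : ℤ)).divNat (θd * ηd * d0z)) := by
    have h := MI.mem_divNat (MI.mem_mulInt (MI.mem_mul hS (MI.mem_ofInt S 1) hF.invPi2)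
      (((θd + θn) * (ηd + ηn) * 2 ^ cd : ℕ) : ℤ)) (n := θd * ηd * d0z) (by positivity)
    refine mem_of_eq h ?_
    push_cast
    field_simp
  have hcB : MI.mem S ((1 + (θn : ℝ) / θd) * (1 + ((ηn : ℝ) / ηd)⁻¹) * (1 / ((d0z : ℝ) * (1 / 2 ^ cd))))
      (((MI.ofInt S 1).mulInt (((θd + θn) * (ηn + ηd) * 2 ^ cd : ℕ) : ℤ)).divNat (θd * ηn * d0z)) := by
    have h := MI.mem_divNat (MI.mem_mulInt (MI.mem_ofInt S 1) (((θd + θn) * (ηn + ηd) * 2 ^ cd : ℕ) : ℤ))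
      (n := θd * ηn * d0z) (by positivity)
    refine mem_of_eq h ?_
    push_cast
    field_simp
  unfold psiMSe psiMSeBox
  split_ifs
  · exact MI.mem_mul hS hcA (mem_sumBox S Je fun j' _ ↦
      MI.mem_mul hS (mem_hankHMSBox hS hcM hcR hpA hX (by omega) hBe (by omega) r j') (mem_vAeBox S i' j'))
  · exact MI.mem_mul hS hcB (mem_sumBox S Je fun r' _ ↦
      MI.mem_mul hS (mem_hankHBox S hpB hX (by omega) hBe (r - Je) r') (mem_vBeBox hS hks hC hF hR))

/-- Box of `ψ⁺(MS)_r(i')·B^{p(r)}`. [cite: Moore1966, Ch. 3 (interval arithmetic: inclusion property)] -/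
def psiMSeSBox (S : ℕ) (C : Consts) (F : FDConsts) (ks : List PrimeLen) (R : IdxRec)
    (cd d0z Be B3e Je θn θd ηn ηd cs : ℕ) (sd1 : List ℕ) (sdm sdp : List (List ℕ)) (i' r : ℕ) : MI :=
  (psiMSeBox S C F ks R cd d0z Be B3e Je θn θd ηn ηd cs sd1 sdm sdp i' r).mulInt ((Be : ℤ) ^ pJe Je r)

/-- [cite: Moore1966, Ch. 3 (interval arithmetic: inclusion property)] -/
theorem mem_psiMSeSBox (hS : 0 < S) (hks : PrimeData a ks) (hC : ConstsValid S a ks C) {F : FDConsts}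
    (hF : FDValid S a F) {cd d0z Be B3e Je θn θd ηn ηd cs : ℕ} {sd1 : List ℕ} {sdm sdp : List (List ℕ)}
    (hd0 : 0 < d0z) (hθn : 0 < θn) (hθd : 0 < θd) (hηn : 0 < ηn) (hηd : 0 < ηd) (hBe : 0 < Be) (hB3 : 2 ≤ B3e)
    {i' r : ℕ} {R : IdxRec} (hR : OffValid S a ks (i' : ℤ) R) :
    MI.mem S (psiMSeS a ((θn : ℝ) / θd) ((ηn : ℝ) / ηd) ((d0z : ℝ) * (1 / 2 ^ cd)) Be B3e Je
        (sFun sd1 cs) (sFun2 sdm cs) (sFun2 sdp cs) i' r)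
      (psiMSeSBox S C F ks R cd d0z Be B3e Je θn θd ηn ηd cs sd1 sdm sdp i' r) := by
  unfold psiMSeS psiMSeSBox
  have h := MI.mem_mulInt (mem_psiMSeBox hS hks hC hF (cd := cd) (cs := cs) (sd1 := sd1) (sdm := sdm) (sdp := sdp)
    hd0 hθn hθd hηn hηd hBe hB3 (Je := Je) (r := r) hR) ((Be : ℤ) ^ pJe Je r)
  refine mem_of_eq h ?_
  push_cast; rfl

/-! ## Odd sector -/

/-- Right factors of the mean-square tail (odd). [cite: Yoshida1992HermitianForms, §7 pp. 305–312] -/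
noncomputable def psiMSo (a θ η d₀ : ℝ) (B B₃ J : ℕ) (s₁ : ℕ → ℝ) (sm sp : ℕ → ℕ → ℝ) (k' r : ℕ) : ℝ :=
  if r < J then
    (1 + θ) * (1 + η) * (1 / (π ^ 2 * d₀)) *
      ∑ j' ∈ Finset.range J,
        hankHMS (msConst a (B₃ + 1) s₁ sm sp) (msRes a s₁ sm sp) pOA B₃ (B₃ + 1) B (B₃ + 1) J r j' * vAo k' j'
  else
    (1 + θ) * (1 + η⁻¹) * (1 / d₀) *
      ∑ r' ∈ Finset.range J, hankH pOB B₃ (B₃ + 1) B J (r - J) r' * vBo a k' r'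

/-- `ψ·B^{p(r)}` (odd). [cite: Yoshida1992HermitianForms, §7 pp. 305–312] -/
noncomputable def psiMSoS (a θ η d₀ : ℝ) (B B₃ J : ℕ) (s₁ : ℕ → ℝ) (sm sp : ℕ → ℕ → ℝ) (k' r : ℕ) : ℝ :=
  psiMSo a θ η d₀ B B₃ J s₁ sm sp k' r * (B : ℝ) ^ pJo J r

/-- **`U₂⁻(MS) = Σ_{r<2J} φ_r ψ_rᵀ + diag`** (unscaled). [cite: Yoshida1992HermitianForms, §7 pp. 305–312] -/
theorem U2OddJMS_eq_factored (a θ η d₀ : ℝ) (B B₃ J : ℕ) (s₁ : ℕ → ℝ) (sm sp : ℕ → ℕ → ℝ) (k k' : ℕ) :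
    U2OddJMS a θ η d₀ B B₃ J s₁ sm sp k k'
      = (∑ r ∈ Finset.range (J + J), phiJo a J k r * psiMSo a θ η d₀ B B₃ J s₁ sm sp k' r)
        + (if k = k' then dgJo a θ d₀ B B₃ J k else 0) := by
  rw [← U2OddJMS'_eq, Finset.sum_range_add]
  unfold U2OddJMS' phiJo psiMSo dgJo
  have hA : ∀ r ∈ Finset.range J, (if r < J then vAo k r else vBo a k (r - J)) *
      (if r < J then (1 + θ) * (1 + η) * (1 / (π ^ 2 * d₀)) *
          ∑ j' ∈ Finset.range J,
            hankHMS (msConst a (B₃ + 1) s₁ sm sp) (msRes a s₁ sm sp) pOA B₃ (B₃ + 1) B (B₃ + 1) J r j' * vAo k' j'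
        else (1 + θ) * (1 + η⁻¹) * (1 / d₀) *
          ∑ r' ∈ Finset.range J, hankH pOB B₃ (B₃ + 1) B J (r - J) r' * vBo a k' r')
      = (1 + θ) * (1 + η) * (1 / (π ^ 2 * d₀)) *
          ∑ j' ∈ Finset.range J,
            hankHMS (msConst a (B₃ + 1) s₁ sm sp) (msRes a s₁ sm sp) pOA B₃ (B₃ + 1) B (B₃ + 1) J r j'
              * vAo k r * vAo k' j' := by
    intro r hr
    rw [if_pos (Finset.mem_range.mp hr), if_pos (Finset.mem_range.mp hr), Finset.mul_sum, Finset.mul_sum, Finset.mul_sum]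
    exact Finset.sum_congr rfl fun j' _ ↦ by ring
  have hB : ∀ r ∈ Finset.range J, (if J + r < J then vAo k (J + r) else vBo a k (J + r - J)) *
      (if J + r < J then (1 + θ) * (1 + η) * (1 / (π ^ 2 * d₀)) *
          ∑ j' ∈ Finset.range J,
            hankHMS (msConst a (B₃ + 1) s₁ sm sp) (msRes a s₁ sm sp) pOA B₃ (B₃ + 1) B (B₃ + 1) J (J + r) j' * vAo k' j'
        else (1 + θ) * (1 + η⁻¹) * (1 / d₀) *
          ∑ r' ∈ Finset.range J, hankH pOB B₃ (B₃ + 1) B J (J + r - J) r' * vBo a k' r')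
      = (1 + θ) * (1 + η⁻¹) * (1 / d₀) *
          ∑ r' ∈ Finset.range J, hankH pOB B₃ (B₃ + 1) B J r r' * vBo a k r * vBo a k' r' := by
    intro r _
    rw [if_neg (by omega), if_neg (by omega), Nat.add_sub_cancel_left, Finset.mul_sum, Finset.mul_sum, Finset.mul_sum]
    exact Finset.sum_congr rfl fun r' _ ↦ by ring
  rw [Finset.sum_congr rfl hA, Finset.sum_congr rfl hB, ← Finset.mul_sum, ← Finset.mul_sum]

/-- **`U₂⁻(MS)`, scaled factorisation** (`B > 0`). [cite: Yoshida1992HermitianForms, §7 pp. 305–312] -/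
theorem U2OddJMS_eq_factoredS (a θ η d₀ : ℝ) {B : ℕ} (hB : 0 < B) (B₃ J : ℕ) (s₁ : ℕ → ℝ) (sm sp : ℕ → ℕ → ℝ)
    (k k' : ℕ) :
    U2OddJMS a θ η d₀ B B₃ J s₁ sm sp k k'
      = (∑ r ∈ Finset.range (J + J), phiJoS a B J k r * psiMSoS a θ η d₀ B B₃ J s₁ sm sp k' r)
        + (if k = k' then dgJo a θ d₀ B B₃ J k else 0) := by
  rw [U2OddJMS_eq_factored]
  congr 1
  refine Finset.sum_congr rfl fun r _ ↦ ?_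
  unfold phiJoS psiMSoS
  have hBp : ((B : ℝ)) ^ pJo J r ≠ 0 := pow_ne_zero _ (by exact_mod_cast hB.ne')
  field_simp

/-- `U₂⁻(MS)(k,k') = U₂⁻(MS)(k',k)`. [cite: Yoshida1992HermitianForms, §7 pp. 305–312] -/
theorem U2OddJMS_comm (a θ η d₀ : ℝ) (B B₃ J : ℕ) (s₁ : ℕ → ℝ) (sm sp : ℕ → ℕ → ℝ) (k k' : ℕ) :
    U2OddJMS a θ η d₀ B B₃ J s₁ sm sp k k' = U2OddJMS a θ η d₀ B B₃ J s₁ sm sp k' k := by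
  rw [← U2OddJMS'_eq, ← U2OddJMS'_eq]
  unfold U2OddJMS'
  have hsA : ∑ j ∈ Finset.range J, ∑ j' ∈ Finset.range J,
        hankHMS (msConst a (B₃ + 1) s₁ sm sp) (msRes a s₁ sm sp) pOA B₃ (B₃ + 1) B (B₃ + 1) J j j' * vAo k j * vAo k' j'
      = ∑ j ∈ Finset.range J, ∑ j' ∈ Finset.range J,
        hankHMS (msConst a (B₃ + 1) s₁ sm sp) (msRes a s₁ sm sp) pOA B₃ (B₃ + 1) B (B₃ + 1) J j j' * vAo k' j * vAo k j' := by
    rw [Finset.sum_comm]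
    refine Finset.sum_congr rfl fun j _ ↦ Finset.sum_congr rfl fun j' _ ↦ ?_
    by_cases hjj : j' = j
    · subst hjj; ring
    · rw [hankHMS_comm _ _ _ _ _ _ _ _ _ _ hjj]; ring
  have hsB : ∑ r ∈ Finset.range J, ∑ r' ∈ Finset.range J, hankH pOB B₃ (B₃ + 1) B J r r' * vBo a k r * vBo a k' r'
      = ∑ r ∈ Finset.range J, ∑ r' ∈ Finset.range J, hankH pOB B₃ (B₃ + 1) B J r r' * vBo a k' r * vBo a k r' := by
    rw [Finset.sum_comm]
    refine Finset.sum_congr rfl fun r _ ↦ Finset.sum_congr rfl fun r' _ ↦ ?_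
    by_cases hrr : r' = r
    · subst hrr; ring
    · rw [hankH_comm _ _ _ _ _ _ _ hrr]; ring
  rw [hsA, hsB]
  by_cases hkk : k = k'
  · subst hkk; rfl
  · rw [if_neg hkk, if_neg (Ne.symm hkk)]

/-- Box of `ψ⁻(MS)_r(k')` (record of mode `k' + 1`). [cite: Moore1966, Ch. 3 (interval arithmetic: inclusion property)] -/
def psiMSoBox (S : ℕ) (C : Consts) (F : FDConsts) (ks : List PrimeLen) (R : IdxRec)
    (cd d0z Bo B3o Jo θn θd ηn ηd cs : ℕ) (sd1 : List ℕ) (sdm sdp : List (List ℕ)) (k' r : ℕ) : MI :=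
  if r < Jo then
    ((((MI.ofInt S 1).mul S F.invPi2).mulInt (((θd + θn) * (ηd + ηn) * 2 ^ cd : ℕ) : ℤ)).divNat (θd * ηd * d0z)).mul S
      (sumBox S (fun j' ↦ (hankHMSBox S (msConstBox S C F ks (B3o + 1) sd1 sdm sdp) (msResBox S C ks sd1 sdm sdp cs)
        pOA B3o (B3o + 1) Bo (B3o + 1) Jo r j').mul S (vAoBox S k' j')) Jo)
  else
    (((MI.ofInt S 1).mulInt (((θd + θn) * (ηn + ηd) * 2 ^ cd : ℕ) : ℤ)).divNat (θd * ηn * d0z)).mul S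
      (sumBox S (fun r' ↦ (hankHBox S pOB B3o (B3o + 1) Bo Jo (r - Jo) r').mul S (vBoBox S C F R k' r')) Jo)

/-- [cite: Moore1966, Ch. 3 (interval arithmetic: inclusion property)] -/
theorem mem_psiMSoBox (hS : 0 < S) (hks : PrimeData a ks) (hC : ConstsValid S a ks C) {F : FDConsts}
    (hF : FDValid S a F) {cd d0z Bo B3o Jo θn θd ηn ηd cs : ℕ} {sd1 : List ℕ} {sdm sdp : List (List ℕ)}
    (hd0 : 0 < d0z) (hθn : 0 < θn) (hθd : 0 < θd) (hηn : 0 < ηn) (hηd : 0 < ηd) (hBo : 0 < Bo) (hB3 : 1 ≤ B3o)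
    {k' r : ℕ} {R : IdxRec} (hR : OffValid S a ks ((k' : ℤ) + 1) R) :
    MI.mem S (psiMSo a ((θn : ℝ) / θd) ((ηn : ℝ) / ηd) ((d0z : ℝ) * (1 / 2 ^ cd)) Bo B3o Jo
        (sFun sd1 cs) (sFun2 sdm cs) (sFun2 sdp cs) k' r)
      (psiMSoBox S C F ks R cd d0z Bo B3o Jo θn θd ηn ηd cs sd1 sdm sdp k' r) := by
  have hπ : (π : ℝ) ≠ 0 := Real.pi_ne_zero
  have hθd' : (θd : ℝ) ≠ 0 := by exact_mod_cast hθd.ne'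
  have hθn' : (θn : ℝ) ≠ 0 := by exact_mod_cast hθn.ne'
  have hηd' : (ηd : ℝ) ≠ 0 := by exact_mod_cast hηd.ne'
  have hηn' : (ηn : ℝ) ≠ 0 := by exact_mod_cast hηn.ne'
  have hd0' : (d0z : ℝ) ≠ 0 := by exact_mod_cast hd0.ne'
  have h2 : (2 : ℝ) ^ cd ≠ 0 := by positivity
  have hpA : ∀ j, 1 ≤ pOA j := fun j ↦ by simp [pOA]
  have hpB : ∀ j, 1 ≤ pOB j := fun j ↦ by simp [pOB]
  have hcM := mem_msConstBox hS hks hC hF (Y := B3o + 1) (by omega) sd1 sdm sdp cs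
  have hcR := mem_msResBox hS hks hC sd1 sdm sdp cs
  have hcA : MI.mem S ((1 + (θn : ℝ) / θd) * (1 + (ηn : ℝ) / ηd) * (1 / (π ^ 2 * ((d0z : ℝ) * (1 / 2 ^ cd)))))
      ((((MI.ofInt S 1).mul S F.invPi2).mulInt (((θd + θn) * (ηd + ηn) * 2 ^ cd : ℕ) : ℤ)).divNat (θd * ηd * d0z)) := by
    have h := MI.mem_divNat (MI.mem_mulInt (MI.mem_mul hS (MI.mem_ofInt S 1) hF.invPi2)
      (((θd + θn) * (ηd + ηn) * 2 ^ cd : ℕ) : ℤ)) (n := θd * ηd * d0z) (by positivity)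
    refine mem_of_eq h ?_
    push_cast
    field_simp
  have hcB : MI.mem S ((1 + (θn : ℝ) / θd) * (1 + ((ηn : ℝ) / ηd)⁻¹) * (1 / ((d0z : ℝ) * (1 / 2 ^ cd))))
      (((MI.ofInt S 1).mulInt (((θd + θn) * (ηn + ηd) * 2 ^ cd : ℕ) : ℤ)).divNat (θd * ηn * d0z)) := by
    have h := MI.mem_divNat (MI.mem_mulInt (MI.mem_ofInt S 1) (((θd + θn) * (ηn + ηd) * 2 ^ cd : ℕ) : ℤ))
      (n := θd * ηn * d0z) (by positivity)
    refine mem_of_eq h ?_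
    push_cast
    field_simp
  unfold psiMSo psiMSoBox
  split_ifs
  · exact MI.mem_mul hS hcA (mem_sumBox S Jo fun j' _ ↦
      MI.mem_mul hS (mem_hankHMSBox hS hcM hcR hpA hB3 (by omega) hBo (by omega) r j') (mem_vAoBox S k' j'))
  · exact MI.mem_mul hS hcB (mem_sumBox S Jo fun r' _ ↦
      MI.mem_mul hS (mem_hankHBox S hpB hB3 (by omega) hBo (r - Jo) r') (mem_vBoBox hS hks hC hF hR))

/-- Box of `ψ⁻(MS)_r(k')·B^{p(r)}`. [cite: Moore1966, Ch. 3 (interval arithmetic: inclusion property)] -/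
def psiMSoSBox (S : ℕ) (C : Consts) (F : FDConsts) (ks : List PrimeLen) (R : IdxRec)
    (cd d0z Bo B3o Jo θn θd ηn ηd cs : ℕ) (sd1 : List ℕ) (sdm sdp : List (List ℕ)) (k' r : ℕ) : MI :=
  (psiMSoBox S C F ks R cd d0z Bo B3o Jo θn θd ηn ηd cs sd1 sdm sdp k' r).mulInt ((Bo : ℤ) ^ pJo Jo r)

/-- [cite: Moore1966, Ch. 3 (interval arithmetic: inclusion property)] -/
theorem mem_psiMSoSBox (hS : 0 < S) (hks : PrimeData a ks) (hC : ConstsValid S a ks C) {F : FDConsts}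
    (hF : FDValid S a F) {cd d0z Bo B3o Jo θn θd ηn ηd cs : ℕ} {sd1 : List ℕ} {sdm sdp : List (List ℕ)}
    (hd0 : 0 < d0z) (hθn : 0 < θn) (hθd : 0 < θd) (hηn : 0 < ηn) (hηd : 0 < ηd) (hBo : 0 < Bo) (hB3 : 1 ≤ B3o)
    {k' r : ℕ} {R : IdxRec} (hR : OffValid S a ks ((k' : ℤ) + 1) R) :
    MI.mem S (psiMSoS a ((θn : ℝ) / θd) ((ηn : ℝ) / ηd) ((d0z : ℝ) * (1 / 2 ^ cd)) Bo B3o Jo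
        (sFun sd1 cs) (sFun2 sdm cs) (sFun2 sdp cs) k' r)
      (psiMSoSBox S C F ks R cd d0z Bo B3o Jo θn θd ηn ηd cs sd1 sdm sdp k' r) := by
  unfold psiMSoS psiMSoSBox
  have h := MI.mem_mulInt (mem_psiMSoBox hS hks hC hF (cd := cd) (cs := cs) (sd1 := sd1) (sdm := sdm) (sdp := sdp)
    hd0 hθn hθd hηn hηd hBo hB3 (Jo := Jo) (r := r) hR) ((Bo : ℤ) ^ pJo Jo r)
  refine mem_of_eq h ?_
  push_cast; rfl

end Encl

end Literature.NumberTheory.LFunctions.Yoshida1992
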